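import Mathlib
import Literature.NumberTheory.LFunctions.Zhang2022.Section12RelCompare
import Literature.NumberTheory.LFunctions.Zhang2022.Section12Lemma122Edge
import Literature.NumberTheory.LFunctions.Zhang2022.Section12Lemma123Edge
import HarnessLib

/-!
# Zhang (2022) §12, Lemmas 12.2–12.3: the Cauchy steps u026 / (12.10) / Lemma 12.3-form in the RELATIVE
# reading (the factor `(∏_{q∣dr}(1−q⁻¹)⁻¹)²` carried through Cauchy's estimate on `|w| = α`)

Topic `Literature/NumberTheory/LFunctions/Zhang2022` (Landau–Siegel audit tree; verdict-neutral).
Y. Zhang, *Discrete mean estimates and the Landau–Siegel zero*, arXiv:2211.02515v1 (2022)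
[Zhang2022LandauSiegel] — **an unrefereed manuscript under adjudication**; ZHANG-L lane, WP12 (typer seat,
task T2). THEOREMS ONLY (no new definition, no new fact); companion of `TypedSection12BRel` (via `Section12RelCompare`). The proofs
of `Sec12B.u026read_of_u024_u025`, `Sec12B.eq1210L15_of_steps`, `Sec12B.lemma123_form_of_steps` (sz-d60:
`Section12Lemma122Edge`, `Section12Lemma123Edge`) with the factor `(∏_{q∣dr}(1−q⁻¹)⁻¹)²` — a constant in `w` —
carried: **`dedU026readRel_holds : DedU026readRel c′`** (`U024Rel → U025Rel → U026readRel`, constant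
`e^{521π}(|C₁|+|C₂|)/π`), **`dedEq1210L15Rel_holds`** (`U026readRel → Eq1210L15Rel`; + `eq1210L15Rel_of_u024Rel_u025Rel`),
**`dedLemma123FormRel_holds`** (`U030Rel → Lemma123FormRel`, constant `e^{π}|C|/(0.504π)`). So the relative
(12.10) and the relative ε-free Lemma 12.3 hold MODULO the relative circle claims `U024Rel ∧ U025Rel` resp.
`U030Rel` only (u023, u027, u029, u031, u033 and the closed form of `circ025` are theorems of
`TypedSection12B`). Nothing here asserts any CLAIM, or anything about Theorems 1–2 / Landau–Siegel zeros.

## References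

* Y. Zhang, arXiv:2211.02515v1 (2022), §12 Lemma 12.2 and its proof pp. 69–70 (tex L3502–L3549), Lemma 12.3
  and its proof pp. 70–71 (tex L3551–L3590). [cite: Zhang2022LandauSiegel, §12 Lemmas 12.2–12.3]
-/

noncomputable section

open Complex Real ComplexConjugate

namespace Literature.NumberTheory.LFunctions.Zhang2022.Typed.Sec12B

open Literature.NumberTheory.LFunctions.Zhang2022.Skeleton

/-! ## The relative Cauchy-step edges (Lemma 12.2: u026, (12.10); Lemma 12.3: evaluation form) -/

section Edges

variable (c' : ℝ) {D : ℕ}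

/-- `α = π/𝓛⁹`. [cite: Zhang2022LandauSiegel, §2 (2.10)] -/
private theorem alpha_eq_div (D : ℕ) : alpha D = π / ell D ^ 9 := by
  rw [alpha, bigP, Real.log_exp]

/-- `α > 0` for `D ≥ 3`. [cite: Zhang2022LandauSiegel, §2 (2.10)] -/
private theorem alpha_pos_three (hD : 3 ≤ D) : 0 < alpha D := by
  rw [alpha_eq_div]; exact div_pos Real.pi_pos (pow_pos (by linarith [one_lt_ell hD]) _)

/-- `log P₁ = 0.504·𝓛⁹`. [cite: Zhang2022LandauSiegel, §2 (2.21)] -/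
private theorem log_P1_eq_ell (D : ℕ) : Real.log (Skeleton.P1 D) = 0.504 * ell D ^ 9 := by
  rw [Skeleton.P1, Real.log_rpow (by rw [bigP]; exact Real.exp_pos _), bigP, Real.log_exp]


/-- `log P₁ > 0` for `D ≥ 3`. [cite: Zhang2022LandauSiegel, §2 (2.21)] -/
private theorem log_P1_pos_three (hD : 3 ≤ D) : 0 < Real.log (Skeleton.P1 D) := by
  rw [log_P1_eq_ell]; exact mul_pos (by norm_num) (pow_pos (by linarith [one_lt_ell hD]) _)

/-- **`DedU026readRel` holds: the Cauchy step of Lemma 12.2 in the relative reading** — the proof of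
`Sec12B.u026read_of_u024_u025` with the factor `relFac(dr)` (a constant in `w`) carried through Cauchy's
estimate on `|w| = α`; constant `e^{521π}(|C₁|+|C₂|)/π`. [cite: Zhang2022LandauSiegel, §12 proof of Lemma 12.2, pp.69–70] -/
theorem u026readRel_of_u024Rel_u025Rel (h24 : U024Rel c') (h25 : U025Rel c') : U026readRel c' := by
  obtain ⟨C₁, h24'⟩ := h24
  obtain ⟨C₂, h25'⟩ := h25
  obtain ⟨D₀, hall⟩ := (h24'.and h25').and (circ025_eq c')
  refine ⟨Real.exp (521 * π) * (|C₁| + |C₂|) / π, max D₀ 3,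
    fun D _ χ hD hq hp hA j hj d r hd hr h1 => ?_⟩
  have hD₀ : D₀ ≤ D := le_trans (le_max_left _ _) hD
  have hD3 : 3 ≤ D := le_trans (le_max_right _ _) hD
  obtain ⟨⟨k24, k25⟩, k25'⟩ := hall D χ hD₀ hq hp
  have hα : 0 < alpha D := alpha_pos_three hD3
  have hℓ : 0 < ell D := by linarith [one_lt_ell hD3]
  have hT : 1 ≤ bigT D := by rw [bigT]; exact Real.one_le_exp (by positivity)
  have h1' : ((d * r : ℕ) : ℝ) ≤ P1pp D := h1.trans (div_le_self (P1pp_pos hD3).le hT)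
  set R : ℝ := (∏ q ∈ (d * r).primeFactors, (1 - (q : ℝ)⁻¹)⁻¹) ^ 2 with hRdef
  have hR : 0 < R := lt_of_lt_of_le one_pos (Section8FrontEnd44ReductionRel.one_le_relFac _)
  set L : ℂ := deriv χ.LFunction 1 * PiW χ d r with hL
  set B : ℂ := betaJ c' D (j + 1) * betaJ c' D (j + 2) with hB
  set E : ℂ → ℂ := fun w => bracket122 c' χ j d r w - L * B * modelInt026 D w with hE
  -- the bound on the circle
  have hcirc : ∀ w ∈ Metric.sphere (0 : ℂ) (alpha D), ‖E w‖ ≤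
      Real.exp (521 * π) * ((|C₁| + |C₂|) * (ell D ^ 15)⁻¹ * R) := by
    intro w hw
    have hw' : ‖w‖ = alpha D := by simpa using hw
    have hwlt : ‖w‖ < 1.2 * alpha D := by rw [hw']; linarith
    obtain ⟨-, e24⟩ := k24 hA j hj d r hd hr h1 w hw'
    have e25 := k25 hA j hj d r hd hr h1 w hw'
    have e25' := k25' j hj d r hd hr w hw'
    have hid : E w = ((((d * r : ℕ) : ℝ) / P1pp D : ℝ) : ℂ) ^ (beta6 D - w) *
        (innerSum c' χ j d r w - L * circ025 c' D j d r w) := by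
      have key := Xpow_mul_closedForm025 c' hD3 j d r hd hr hwlt
      rw [← e25'] at key
      simp only [hE, bracket122]
      linear_combination L * key
    rw [hid, norm_mul]
    have h15 : 0 ≤ (ell D ^ 15)⁻¹ := inv_nonneg.mpr (pow_nonneg hℓ.le _)
    have hin : ‖innerSum c' χ j d r w - L * circ025 c' D j d r w‖ ≤
        (|C₁| + |C₂|) * (ell D ^ 15)⁻¹ * R := by
      calc ‖innerSum c' χ j d r w - L * circ025 c' D j d r w‖
          ≤ ‖innerSum c' χ j d r w - lineInt024 c' χ j d r w‖ +
              ‖lineInt024 c' χ j d r w - L * circ025 c' D j d r w‖ :=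
            norm_sub_le_norm_sub_add_norm_sub _ _ _
        _ ≤ C₁ * (ell D ^ 15)⁻¹ * R + C₂ * (ell D ^ 15)⁻¹ * R := add_le_add e24 e25
        _ ≤ |C₁| * (ell D ^ 15)⁻¹ * R + |C₂| * (ell D ^ 15)⁻¹ * R := by
            gcongr <;> exact le_abs_self _
        _ = (|C₁| + |C₂|) * (ell D ^ 15)⁻¹ * R := by ring
    exact mul_le_mul (norm_Xpow_le_small hD3 d r hd hr h1' hw') hin (norm_nonneg _)
      (Real.exp_pos _).le
  -- holomorphy on a neighbourhood of the closed disc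
  have hdiff : DiffContOnCl ℂ E (Metric.ball (0 : ℂ) (alpha D)) := by
    have hsub : Metric.closedBall (0 : ℂ) (alpha D) ⊆ Metric.ball (0 : ℂ) (1.2 * alpha D) :=
      Metric.closedBall_subset_ball (by linarith)
    refine DifferentiableOn.diffContOnCl_ball (U := Metric.ball (0 : ℂ) (1.2 * alpha D)) ?_ hsub
    exact ((differentiable_bracket122 c' χ hD3 j d r hd hr).differentiableOn).sub
      ((differentiableOn_modelInt026 hD3).const_mul _)
  have hderiv := Complex.norm_deriv_le_of_forall_mem_sphere_norm_le hα hdiff hcirc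
  -- split the derivative
  have hBr : DifferentiableAt ℂ (bracket122 c' χ j d r) 0 :=
    (differentiable_bracket122 c' χ hD3 j d r hd hr) 0
  have hM : DifferentiableAt ℂ (modelInt026 D) 0 :=
    (differentiableOn_modelInt026 hD3).differentiableAt
      (Metric.isOpen_ball.mem_nhds (Metric.mem_ball_self (by positivity)))
  have hsplit : deriv E 0 = deriv (bracket122 c' χ j d r) 0 - L * B * deriv (modelInt026 D) 0 := by
    simp only [hE]
    rw [deriv_fun_sub hBr (hM.const_mul _), deriv_const_mul _ hM]
  rw [hsplit, hL, hB] at hderiv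
  have hrw : deriv χ.LFunction 1 * PiW χ d r * (betaJ c' D (j + 1) * betaJ c' D (j + 2)) *
      deriv (modelInt026 D) 0 =
      deriv χ.LFunction 1 * PiW χ d r * betaJ c' D (j + 1) * betaJ c' D (j + 2) *
        deriv (modelInt026 D) 0 := by ring
  rw [hrw] at hderiv
  refine hderiv.trans (le_of_eq ?_)
  rw [alpha_eq_div]
  have h9 : ell D ^ 9 ≠ 0 := pow_ne_zero _ hℓ.ne'
  have h15 : ell D ^ 15 ≠ 0 := pow_ne_zero _ hℓ.ne'
  have h6 : ell D ^ 6 ≠ 0 := pow_ne_zero _ hℓ.ne'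
  have hπ : (π : ℝ) ≠ 0 := Real.pi_ne_zero
  field_simp

/-- **`DedU026readRel` holds** (packaged). [cite: Zhang2022LandauSiegel, §12 proof of Lemma 12.2, pp.69–70] -/
theorem dedU026readRel_holds : DedU026readRel c' :=
  fun h24 h25 => u026readRel_of_u024Rel_u025Rel c' h24 h25

/-- `DedU026readRel` — `_holds` alias of `dedU026readRel_holds` above under the fact's exact name (appended
2026-08-28, D-0026 bookkeeping: the proof term is the existing theorem of this file; no statement,
definition or attribute is edited; no new named fact; the ledger's debt table listed the fact
unproved). [cite: Zhang2022LandauSiegel, §12 proof of Lemma 12.2, pp.69–70] -/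
theorem _root_.Literature.NumberTheory.LFunctions.Zhang2022.Typed.Sec12B.DedU026readRel_holds :
    DedU026readRel c' :=
  _root_.Literature.NumberTheory.LFunctions.Zhang2022.Typed.Sec12B.dedU026readRel_holds (c' := c')

/-- **`DedEq1210L15Rel` holds: (12.10) on `dr ≤ P″₁/T` with error `C𝓛⁻¹⁵·relFac(dr)` from the relative u026**
— the proof of `Sec12B.eq1210L15_of_steps` (u023 = `U023_holds`, u027 = `U027_holds`, `b*`,
`log P₁ = 0.504 log P`) with the factor carried. [cite: Zhang2022LandauSiegel, §12 (12.10) pp.69–70] -/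
theorem eq1210L15Rel_of_u026readRel (h26 : U026readRel c') : Eq1210L15Rel c' := by
  obtain ⟨C, h26'⟩ := h26
  obtain ⟨D₀, hall⟩ := ((U023_holds c').and h26').and U027_holds
  refine ⟨C / 0.504, max D₀ 3, fun D _ χ hD hq hp hA j hj d r hd hr h1 => ?_⟩
  have hD₀ : D₀ ≤ D := le_trans (le_max_left _ _) hD
  have hD3 : 3 ≤ D := le_trans (le_max_right _ _) hD
  obtain ⟨⟨k23, k26⟩, k27⟩ := hall D χ hD₀ hq hp
  have e23 := k23 j hj d r hd hr
  have e26 := k26 hA j hj d r hd hr h1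
  have hℓ : 0 < ell D := by linarith [one_lt_ell hD3]
  have hlogPeq : Real.log (bigP D) = ell D ^ 9 := by rw [bigP, Real.log_exp]
  have hlogP : 0 < Real.log (bigP D) := by rw [hlogPeq]; exact pow_pos hℓ _
  have hlogP1 : 0 < Real.log (Skeleton.P1 D) := log_P1_pos_three hD3
  have hlogc : (Real.log (Skeleton.P1 D) : ℂ) ≠ 0 := by exact_mod_cast hlogP1.ne'
  have hlogPc : (Real.log (bigP D) : ℂ) ≠ 0 := by exact_mod_cast hlogP.ne'
  set R : ℝ := (∏ q ∈ (d * r).primeFactors, (1 - (q : ℝ)⁻¹)⁻¹) ^ 2 with hRdef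
  set L : ℂ := deriv χ.LFunction 1 * PiW χ d r with hL
  -- the main term: −(1/log P₁)·L·β'β''·(deriv modelInt026 0) = main1210
  have hmain : -(1 / (Real.log (Skeleton.P1 D) : ℂ)) *
      (L * betaJ c' D (j + 1) * betaJ c' D (j + 2) * deriv (modelInt026 D) 0) =
        main1210 c' χ j d r := by
    rw [k27, main1210, bstar_eq_display, hL]
    set J : ℂ := ∫ z in (0 : ℝ)..0.004, (z : ℂ) * cexp (3 * π * I * z / 2) with hJ
    have hP1c : (Real.log (Skeleton.P1 D) : ℂ) = 0.504 * (Real.log (bigP D) : ℂ) := by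
      rw [log_P1_eq_ell, hlogPeq]; push_cast; ring
    rw [hP1c]
    push_cast
    field_simp
  have hid : sum122 c' χ j d r - main1210 c' χ j d r =
      -(1 / (Real.log (Skeleton.P1 D) : ℂ)) *
        (deriv (bracket122 c' χ j d r) 0 -
          L * betaJ c' D (j + 1) * betaJ c' D (j + 2) * deriv (modelInt026 D) 0) := by
    rw [e23, ← hmain]; ring
  rw [hid, norm_mul, norm_neg, norm_div, norm_one, Complex.norm_real, Real.norm_eq_abs,
    abs_of_pos hlogP1]
  have hval : 1 / Real.log (Skeleton.P1 D) * (C * (ell D ^ 6)⁻¹ * R) =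
      C / 0.504 * (ell D ^ 15)⁻¹ * R := by
    rw [log_P1_eq_ell]
    have h9 : ell D ^ 9 ≠ 0 := pow_ne_zero _ hℓ.ne'
    have h6 : ell D ^ 6 ≠ 0 := pow_ne_zero _ hℓ.ne'
    have h15 : ell D ^ 15 ≠ 0 := pow_ne_zero _ hℓ.ne'
    field_simp
  calc 1 / Real.log (Skeleton.P1 D) *
        ‖deriv (bracket122 c' χ j d r) 0 -
          L * betaJ c' D (j + 1) * betaJ c' D (j + 2) * deriv (modelInt026 D) 0‖
      ≤ 1 / Real.log (Skeleton.P1 D) * (C * (ell D ^ 6)⁻¹ * R) :=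
        mul_le_mul_of_nonneg_left e26 (by positivity)
    _ = C / 0.504 * (ell D ^ 15)⁻¹ * R := hval

/-- **`DedEq1210L15Rel` holds** (packaged). [cite: Zhang2022LandauSiegel, §12 (12.10) p.70] -/
theorem dedEq1210L15Rel_holds : DedEq1210L15Rel c' :=
  fun h26 => eq1210L15Rel_of_u026readRel c' h26

/-- `DedEq1210L15Rel` — `_holds` alias of `dedEq1210L15Rel_holds` above under the fact's exact name (appended
2026-08-28, D-0026 bookkeeping: the proof term is the existing theorem of this file; no statement,
definition or attribute is edited; no new named fact; the ledger's debt table listed the fact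
unproved). [cite: Zhang2022LandauSiegel, §12 (12.10) p.70] -/
theorem _root_.Literature.NumberTheory.LFunctions.Zhang2022.Typed.Sec12B.DedEq1210L15Rel_holds :
    DedEq1210L15Rel c' :=
  _root_.Literature.NumberTheory.LFunctions.Zhang2022.Typed.Sec12B.dedEq1210L15Rel_holds (c' := c')

/-- **(12.10) in the relative reading from the two relative circle claims** (`U024Rel`, `U025Rel`).
[cite: Zhang2022LandauSiegel, §12 (12.10) pp.69–70] -/
theorem eq1210L15Rel_of_u024Rel_u025Rel (h24 : U024Rel c') (h25 : U025Rel c') : Eq1210L15Rel c' :=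
  eq1210L15Rel_of_u026readRel c' (u026readRel_of_u024Rel_u025Rel c' h24 h25)

/-- **`DedLemma123FormRel` holds: Lemma 12.3 in its ε-free evaluation form with error `C𝓛⁻¹⁵·relFac(dr)`
from the relative u030** — the proof of `Sec12B.lemma123_form_of_steps` (u029, u031, u033 = THEOREMS) with
`Sec12B.norm_deriv_error_le` applied to the constant `|C|·relFac(dr)`; constant `e^{π}|C|/(0.504π)`.
[cite: Zhang2022LandauSiegel, §12 Lemma 12.3 (proof), pp.70–71] -/
theorem lemma123FormRel_of_u030Rel (h30 : U030Rel c') : Lemma123FormRel c' := by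
  obtain ⟨C, h30'⟩ := h30
  obtain ⟨D₀, hall⟩ := (((U029_holds c').and h30').and (U031_holds c')).and (U033_holds c')
  refine ⟨Real.exp π * |C| / (0.504 * π), max D₀ 3, fun D _ χ hD hq hp hA j hj d r hd hr h1 h2 => ?_⟩
  have hD₀ : D₀ ≤ D := le_trans (le_max_left _ _) hD
  have hD3 : 3 ≤ D := le_trans (le_max_right _ _) hD
  obtain ⟨⟨⟨k29, k30⟩, k31⟩, k33⟩ := hall D χ hD₀ hq hp
  have e29 := k29 j hj d r hd hr h1 h2
  have e33 := k33 j hj d r hd hr h1 h2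
  have hα : 0 < alpha D := alpha_pos_three hD3
  have hℓ : 0 < ell D := by linarith [one_lt_ell hD3]
  set R : ℝ := (∏ q ∈ (d * r).primeFactors, (1 - (q : ℝ)⁻¹)⁻¹) ^ 2 with hRdef
  have hR : 0 < R := lt_of_lt_of_le one_pos (Section8FrontEnd44ReductionRel.one_le_relFac _)
  -- u030Rel with the constant `|C|·R`, as an absolute bound in `w`
  have k30abs : ∀ w : ℂ, ‖w‖ = alpha D →
      ‖innerSumLow c' χ j d r w - deriv χ.LFunction 1 * PiW χ d r * circ030 c' D j d r w‖ ≤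
        (|C| * R) * (ell D ^ 15)⁻¹ := by
    intro w hw
    have h15 : 0 ≤ (ell D ^ 15)⁻¹ := inv_nonneg.mpr (pow_nonneg hℓ.le _)
    calc ‖innerSumLow c' χ j d r w - deriv χ.LFunction 1 * PiW χ d r * circ030 c' D j d r w‖
        ≤ C * (ell D ^ 15)⁻¹ * R := k30 hA j hj d r hd hr h1 h2 w hw
      _ ≤ |C| * (ell D ^ 15)⁻¹ * R := by gcongr; exact le_abs_self C
      _ = (|C| * R) * (ell D ^ 15)⁻¹ := by ring
  have hderiv := norm_deriv_error_le c' χ hD3 j d r hd hr h1 h2 k30abs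
    (fun w hw => k31 j hj d r hd hr h1 h2 w hw)
  have hB : DifferentiableAt ℂ (bracket123 c' χ j d r) 0 :=
    (differentiable_bracket123 c' χ hD3 j d r hd hr) 0
  have hF : DifferentiableAt ℂ (F032 c' D j d r) 0 :=
    (differentiableOn_F032 c' hD3 j d r hd hr).differentiableAt
      (Metric.isOpen_ball.mem_nhds (Metric.mem_ball_self (by positivity)))
  have hsplit : deriv (fun w => bracket123 c' χ j d r w -
      deriv χ.LFunction 1 * PiW χ d r * F032 c' D j d r w) 0 =
      deriv (bracket123 c' χ j d r) 0 -
        deriv χ.LFunction 1 * PiW χ d r * deriv (F032 c' D j d r) 0 := by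
    rw [deriv_fun_sub hB (hF.const_mul _), deriv_const_mul _ hF]
  rw [hsplit, e33] at hderiv
  have hlogP1 : 0 < Real.log (Skeleton.P1 D) := log_P1_pos_three hD3
  have hid : sum122 c' χ j d r +
      1 / (Real.log (Skeleton.P1 D) : ℂ) * (deriv χ.LFunction 1 * PiW χ d r) * rhs033 c' D j d r =
      -(1 / (Real.log (Skeleton.P1 D) : ℂ)) *
        (deriv (bracket123 c' χ j d r) 0 -
          deriv χ.LFunction 1 * PiW χ d r * rhs033 c' D j d r) := by
    rw [e29]; ring
  rw [hid, norm_mul, norm_neg, norm_div, norm_one, Complex.norm_real, Real.norm_eq_abs,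
    abs_of_pos hlogP1]
  have hval : 1 / Real.log (Skeleton.P1 D) * (Real.exp π * (|C| * R) * (ell D ^ 15)⁻¹ / alpha D) =
      Real.exp π * |C| / (0.504 * π) * (ell D ^ 15)⁻¹ * R := by
    rw [log_P1_eq_ell, alpha_eq_div]
    have h9 : ell D ^ 9 ≠ 0 := pow_ne_zero _ hℓ.ne'
    have h15 : ell D ^ 15 ≠ 0 := pow_ne_zero _ hℓ.ne'
    have hπ : (π : ℝ) ≠ 0 := Real.pi_ne_zero
    field_simp
  calc 1 / Real.log (Skeleton.P1 D) *
        ‖deriv (bracket123 c' χ j d r) 0 - deriv χ.LFunction 1 * PiW χ d r * rhs033 c' D j d r‖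
      ≤ 1 / Real.log (Skeleton.P1 D) * (Real.exp π * (|C| * R) * (ell D ^ 15)⁻¹ / alpha D) :=
        mul_le_mul_of_nonneg_left hderiv (by positivity)
    _ = Real.exp π * |C| / (0.504 * π) * (ell D ^ 15)⁻¹ * R := hval

/-- **`DedLemma123FormRel` holds** (packaged). [cite: Zhang2022LandauSiegel, §12 Lemma 12.3 pp.70–71] -/
theorem dedLemma123FormRel_holds : DedLemma123FormRel c' :=
  fun h30 => lemma123FormRel_of_u030Rel c' h30

/-- `DedLemma123FormRel` — `_holds` alias of `dedLemma123FormRel_holds` above under the fact's exact name (appended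
2026-08-28, D-0026 bookkeeping: the proof term is the existing theorem of this file; no statement,
definition or attribute is edited; no new named fact; the ledger's debt table listed the fact
unproved). [cite: Zhang2022LandauSiegel, §12 Lemma 12.3 pp.70–71] -/
theorem _root_.Literature.NumberTheory.LFunctions.Zhang2022.Typed.Sec12B.DedLemma123FormRel_holds :
    DedLemma123FormRel c' :=
  _root_.Literature.NumberTheory.LFunctions.Zhang2022.Typed.Sec12B.dedLemma123FormRel_holds (c' := c')

/-- The absolute evaluation form of Lemma 12.3 (conclusion of `Sec12B.lemma123_form_of_u030`) implies the
relative one. [cite: Zhang2022LandauSiegel, §12 Lemma 12.3 pp.70–71] -/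
theorem lemma123FormRel_of_u030 (h30 : U030 c') : Lemma123FormRel c' :=
  lemma123FormRel_of_u030Rel c' (u030Rel_of_u030 h30)

end Edges

end Literature.NumberTheory.LFunctions.Zhang2022.Typed.Sec12B
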